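/-
Copyright (c) 2026 the pub-hodgecm-mathlib formalisation cell (harness21).  Prover seat hodgecm-mathlib-LH4-p03 (g5), 2026-09-02: «WILD RAMIFIED BLOCK — ONE PACKAGE»
(name F0P3a-p06 (g18) 10:12:43Z): the `h2`-free twin of ★ `ramifiedBlock_adicCompletion`.
-/
import Literature.NumberTheory.Automorphic.RamifiedPlaceLevelNorms   -- ★ p850931 (this seat): `exists_mul_galAdicCompletionMap_eq_of_valued_sub_one_le'`; brings ★ p850872 `RamifiedPlaceDifferent` (`exists_different_of_ramified`, the skew criteria)
import HarnessLib

/-!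
# The ramified block at ANY ramified CM place (no `|2|_w = 1`): different number `d`, a skew unit-or-uniformiser `α`, residual depth `σ_w ≡ id (mod 𝔭_w^d)`,
# and level norms — one package, in the clause order of ★ `ramifiedBlock_adicCompletion` (Serre, *Local Fields* IV §1–2, V §3; Jacobowitz 1962 §§9–11)

Topic `NumberTheory/Automorphic`; namespace `Literature.NumberTheory.Automorphic.UnitaryGroup`.  THEOREMS ONLY (no definition, no instance, no notation, no named fact,
no `sorry`; axioms ⊆ {propext, Classical.choice, Quot.sound}).  Cell `pub/hodgecm-mathlib` (D-0151), crux H413 = `stmt-HodgeConjecture-24833`; half A line LH4, DYADIC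
pay-down leaf `Cruxes/H413/Lines/F0_P3c_DyadicPaydown.lean`, organ (D-RAM) (PRINT by ruling D74′; SCOPE-AUDIT b4c76626: COVERED at `v ∣ 2`).  HONEST READER LABEL: banked base
layer; consumers: none live; count-neutral.  HC_CM is proved only modulo the 7 printed citations (2 remaining named inputs: hLiu418 = stmt-HodgeConjecture-24832, h413 =
stmt-HodgeConjecture-24833) until rung 0 closes.

THE TAME BLOCK ★ `Rogawski1990.ramifiedBlock_adicCompletion (he) (h2 : |2|_w = 1)` (the producer of `(hϖ) (hσϖ) (hres) (hnorm)` for the 411-file tame frame) reads: a uniformiser `ϖ`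
with `σ_w ϖ = −ϖ`; `|σ_w x − x| < 1` on `𝒪_w`; every `σ_w`-fixed principal unit `u` is a norm `z·σ_w z` with `|z − 1| ≤ |u − 1|`.  At a WILD place (`|2|_w < 1`) each clause changes by
the different number `d = ord_w(σ_w τ − τ) ≥ 2` (★ `exists_different_of_ramified`): the skew element `α` is a UNIFORMISER iff `exp(−d) = |2|_w·exp(−1)` (`d` odd, maximal) and
otherwise a UNIT (★ `exists_skew_uniformizer_iff` ∕ `exists_skew_unit_iff`); the residual depth is `|σ_w x − x| ≤ exp(−d)`; and the level norms are `N(U_w^{(2n−d+1)}) = ι U_v^{(n)}`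
for `n ≥ d` (★ p850931 `exists_mul_galAdicCompletionMap_eq_of_valued_sub_one_le'`).
* **`ramifiedBlock_adicCompletion_of_ramified (he)`** — ONE PACKAGE `∃ d α, 1 ≤ d ∧ (∀ τ unif., |στ − τ| = exp(−d)) ∧ σα = −α ∧ (|α| = 1 ∨ |α| = exp(−1)) ∧ (|α| = exp(−1) ↔
  exp(−d) = |2|_w·exp(−1)) ∧ (∀ x ∈ 𝒪_w, |σx − x| ≤ exp(−d)) ∧ (∀ u, σu = u → |u − 1| ≤ exp(−2d) → ∃ z, z·σz = u ∧ |z − 1|·exp(−d) ≤ |u − 1|·exp(−1))`, clause order (α, hres,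
  hnorm) as in ★ so that a (D-RAM) consumer swaps one call.
* `different_eq_one_iff_valued_two_eq_one (he) (hd)` — `d = 1 ↔ |2|_w = 1` for any `d` with the different clause; **`ramifiedBlock_tame_of_valued_two_eq_one (he) (h2)`** — the TAME SPECIALISATION: any `(d, α)` with the package's clauses 2 and 5 has `d = 1` and `|α| = exp(−1)` when `|2|_w = 1`
  (★ `valued_galAdicCompletionMap_sub_self_eq_exp_neg_one_iff`); and **`ramifiedBlock_adicCompletion_tame_of_wild (he) (h2)`** re-derives ★'s four tame clauses VERBATIM from the wild
  package (a `σ`-fixed `u` with `|u − 1| < 1` has `|u − 1| ≤ exp(−2)` because it descends to `L⁺_v`, ★ `exists_toPlace_eq_of_galAdicCompletionMap_eq`).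

## References
* [Serre1979] J.-P. Serre, *Local Fields*, GTM 67 (1979): Ch. IV §1 Prop. 4, §2 (the quadratic case), Ch. V §3 Cor. 3, Ch. III §6 Cor. 2.
* [Jacobowitz1962] R. Jacobowitz, *Hermitian forms over local fields*, Amer. J. Math. 84 (1962), §§9–11 (ramified dyadic: «R-U» `E = F(√u)` vs «R-P» `E = F(√π)`).
* [NeukirchANT1999] J. Neukirch, *Algebraic Number Theory* (1999), Ch. V (1.2)–(1.3), Ch. II (6.8)–(6.9).
-/

set_option autoImplicit false

noncomputable section

open NumberField IsDedekindDomain ValuativeRel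
open scoped ValuativeRel WithZero

namespace Literature.NumberTheory.Automorphic.UnitaryGroup

variable (L : Type) [Field L] [NumberField L] [IsCMField L] (v : HeightOneSpectrum (𝓞 ↥(maximalRealSubfield L)))
  (w : PlacesOver L v) (hw : IsCMField.complexConj L • w.1 = w.1) (he : v.asIdeal.ramificationIdx' w.1.asIdeal ≠ 1)

omit [IsCMField L] in
/-- `L_w` has a uniformiser of valuation `exp(−1)` (Mathlib `valuation_exists_uniformizer`, in the `Valued.v` spelling). [cite: Serre1979, Ch. I §1] -/
theorem exists_valued_eq_exp_neg_one : ∃ τ : w.1.adicCompletion L, Valued.v τ = WithZero.exp (-1 : ℤ) := by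
  obtain ⟨π, hπ⟩ := w.1.valuation_exists_uniformizer L
  exact ⟨(π : w.1.adicCompletion L), by rw [HeightOneSpectrum.valuedAdicCompletion_eq_valuation', hπ]⟩

/-- In `ℤᵐ⁰`: `exp(−d)² = exp(−2d)`. [cite: Serre1979, Ch. II §1] -/
theorem exp_neg_sq_eq_exp_neg_two_mul (d : ℕ) : WithZero.exp (-(d : ℤ)) ^ 2 = WithZero.exp (-(2 * (d : ℤ))) := by
  rw [← WithZero.exp_nsmul]; simp only [nsmul_eq_mul, Nat.cast_ofNat, mul_neg]

/-- In `ℤᵐ⁰`: cancel a common factor `exp k`. [cite: Serre1979, Ch. II §1] -/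
theorem le_of_mul_exp_le_mul_exp {a b : WithZero (Multiplicative ℤ)} {k : ℤ} (h : a * WithZero.exp k ≤ b * WithZero.exp k) : a ≤ b := by
  have h' := mul_le_mul_left h (WithZero.exp (-k))
  rwa [mul_assoc, mul_assoc, ← WithZero.exp_add, add_neg_cancel, WithZero.exp_zero, mul_one, mul_one] at h'

include he in
/-- **THE RAMIFIED BLOCK AT ANY RAMIFIED CM PLACE — ONE PACKAGE** (the `h2`-free twin of ★ `Rogawski1990.ramifiedBlock_adicCompletion`, clause order (α, hres, hnorm)): there are `d : ℕ` and
`α ∈ L_w` with: `1 ≤ d`; every uniformiser `τ` has `|σ_w τ − τ| = exp(−d)` (the different number, ★ `exists_different_of_ramified`); `σ_w α = −α` with `α` a UNIT or a UNIFORMISER, and a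
uniformiser EXACTLY when `exp(−d) = |2|_w · exp(−1)` (★ `exists_skew_uniformizer_iff` ∕ `exists_skew_unit_iff`: at a wild place of even `d` no skew uniformiser exists); residual depth
`|σ_w x − x| ≤ exp(−d)` on `𝒪_w`; and LEVEL NORMS: every `σ_w`-fixed `u` with `|u − 1|_w ≤ exp(−2d)` is `z·σ_w z` with `|z − 1|_w · exp(−d) ≤ |u − 1|_w · exp(−1)` (★ p850931, Serre V §3
Cor. 3).  No hypothesis on the residue characteristic. [cite: Serre1979, Ch. IV §1 Prop. 4, Ch. IV §2, Ch. V §3 Cor. 3] [cite: Jacobowitz1962, §§9–11] -/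
theorem ramifiedBlock_adicCompletion_of_ramified :
    ∃ (d : ℕ) (α : w.1.adicCompletion L), 1 ≤ d ∧
      (∀ τ : w.1.adicCompletion L, Valued.v τ = WithZero.exp (-1 : ℤ) →
        Valued.v (galAdicCompletionMap (L := L) (IsCMField.complexConj L) hw τ - τ) = WithZero.exp (-(d : ℤ))) ∧
      galAdicCompletionMap (L := L) (IsCMField.complexConj L) hw α = -α ∧
      (Valued.v α = 1 ∨ Valued.v α = WithZero.exp (-1 : ℤ)) ∧
      (Valued.v α = WithZero.exp (-1 : ℤ) ↔ WithZero.exp (-(d : ℤ)) = Valued.v (2 : w.1.adicCompletion L) * WithZero.exp (-1 : ℤ)) ∧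
      (∀ x : w.1.adicCompletion L, Valued.v x ≤ 1 →
        Valued.v (galAdicCompletionMap (L := L) (IsCMField.complexConj L) hw x - x) ≤ WithZero.exp (-(d : ℤ))) ∧
      (∀ u : w.1.adicCompletion L, galAdicCompletionMap (L := L) (IsCMField.complexConj L) hw u = u →
        Valued.v (u - 1) ≤ WithZero.exp (-(2 * (d : ℤ))) →
          ∃ z : w.1.adicCompletion L, z * galAdicCompletionMap (L := L) (IsCMField.complexConj L) hw z = u ∧
            Valued.v (z - 1) * WithZero.exp (-(d : ℤ)) ≤ Valued.v (u - 1) * WithZero.exp (-1 : ℤ)) := by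
  obtain ⟨d, hd1, hdiff, hres, hle, -, hunif, hunit⟩ := exists_different_of_ramified L v w hw he
  obtain ⟨τ, hτ⟩ := exists_valued_eq_exp_neg_one L v w
  -- the level norms from ★ p850931 at the uniformiser `τ`
  have hnorm : ∀ u : w.1.adicCompletion L, galAdicCompletionMap (L := L) (IsCMField.complexConj L) hw u = u →
      Valued.v (u - 1) ≤ WithZero.exp (-(2 * (d : ℤ))) →
        ∃ z : w.1.adicCompletion L, z * galAdicCompletionMap (L := L) (IsCMField.complexConj L) hw z = u ∧
          Valued.v (z - 1) * WithZero.exp (-(d : ℤ)) ≤ Valued.v (u - 1) * WithZero.exp (-1 : ℤ) := by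
    intro u hσu hu
    have hu' : Valued.v (u - 1) ≤ Valued.v (galAdicCompletionMap (L := L) (IsCMField.complexConj L) hw τ - τ) ^ 2 := by
      rw [hdiff τ hτ, exp_neg_sq_eq_exp_neg_two_mul]; exact hu
    obtain ⟨z, hz, hlev⟩ := exists_mul_galAdicCompletionMap_eq_of_valued_sub_one_le' L v w hw he hτ u hσu hu'
    rw [hdiff τ hτ] at hlev
    exact ⟨z, hz, hlev⟩
  by_cases hcase : WithZero.exp (-(d : ℤ)) = Valued.v (2 : w.1.adicCompletion L) * WithZero.exp (-1 : ℤ)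
  · -- `d` maximal (odd): a skew UNIFORMISER
    obtain ⟨ϖ, hϖ, hσϖ⟩ := hunif.2 hcase
    exact ⟨d, ϖ, hd1, hdiff, hσϖ, Or.inr hϖ, ⟨fun _ => hcase, fun _ => hϖ⟩, hres, hnorm⟩
  · -- otherwise: a skew UNIT
    obtain ⟨α, hα, hσα⟩ := hunit.2 (lt_of_le_of_ne hle (Ne.symm hcase))
    refine ⟨d, α, hd1, hdiff, hσα, Or.inl hα, ⟨fun h => ?_, fun h => absurd h hcase⟩, hres, hnorm⟩
    rw [hα, ← WithZero.exp_zero, WithZero.exp_inj] at h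
    omega

include he in
/-- **THE TAME SPECIALISATION**: if `|2|_w = 1`, any `(d, α)` satisfying the package's different clause and its uniformiser criterion has `d = 1` and `|α| = exp(−1)` — the wild package
collapses to ★ `ramifiedBlock_adicCompletion`'s skew uniformiser (★ `valued_galAdicCompletionMap_sub_self_eq_exp_neg_one_iff`: `d = 1 ⟺` tame). [cite: Serre1979, Ch. IV §1 Prop. 4, Ch. IV §2] -/
theorem ramifiedBlock_tame_of_valued_two_eq_one (h2 : Valued.v (2 : w.1.adicCompletion L) = 1) {d : ℕ} {α : w.1.adicCompletion L}
    (hd : ∀ τ : w.1.adicCompletion L, Valued.v τ = WithZero.exp (-1 : ℤ) →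
      Valued.v (galAdicCompletionMap (L := L) (IsCMField.complexConj L) hw τ - τ) = WithZero.exp (-(d : ℤ)))
    (hα : Valued.v α = WithZero.exp (-1 : ℤ) ↔ WithZero.exp (-(d : ℤ)) = Valued.v (2 : w.1.adicCompletion L) * WithZero.exp (-1 : ℤ)) :
    d = 1 ∧ Valued.v α = WithZero.exp (-1 : ℤ) := by
  obtain ⟨τ, hτ⟩ := exists_valued_eq_exp_neg_one L v w
  have hd1 : WithZero.exp (-(d : ℤ)) = WithZero.exp (-1 : ℤ) := by
    rw [← hd τ hτ]; exact (valued_galAdicCompletionMap_sub_self_eq_exp_neg_one_iff L v w hw he hτ).2 h2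
  refine ⟨?_, hα.2 (by rw [hd1, h2, one_mul])⟩
  rw [WithZero.exp_inj] at hd1
  omega

include he in
/-- **`d = 1 ⟺ TAME`** for any `d` satisfying the package's different clause (LH4-plan (g5) WORD #11; F0P3a-p06 (g18)'s clause): `d = 1 ↔ |2|_w = 1`
(★ `valued_galAdicCompletionMap_sub_self_eq_exp_neg_one_iff` at any uniformiser). [cite: Serre1979, Ch. IV §1 Prop. 4, Ch. IV §2] -/
theorem different_eq_one_iff_valued_two_eq_one {d : ℕ}
    (hd : ∀ τ : w.1.adicCompletion L, Valued.v τ = WithZero.exp (-1 : ℤ) →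
      Valued.v (galAdicCompletionMap (L := L) (IsCMField.complexConj L) hw τ - τ) = WithZero.exp (-(d : ℤ))) :
    d = 1 ↔ Valued.v (2 : w.1.adicCompletion L) = 1 := by
  obtain ⟨τ, hτ⟩ := exists_valued_eq_exp_neg_one L v w
  rw [← valued_galAdicCompletionMap_sub_self_eq_exp_neg_one_iff L v w hw he hτ, hd τ hτ, WithZero.exp_inj]
  omega

include he in
/-- **★'S TAME BLOCK RE-DERIVED FROM THE WILD PACKAGE** (`|2|_w = 1`): a uniformiser `ϖ` with `σ_w ϖ = −ϖ`, `|σ_w x − x| < 1` on `𝒪_w`, and every `σ_w`-fixed `u` with `|u − 1| < 1` is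
`z·σ_w z` with `|z − 1| ≤ |u − 1|` — the four clauses of ★ `Rogawski1990.ramifiedBlock_adicCompletion` VERBATIM (a `σ`-fixed `u` descends to `L⁺_v`, ★ `exists_toPlace_eq_of_galAdicCompletionMap_eq`,
so `|u − 1| < 1` forces `|u − 1| ≤ exp(−2)`).  The (D-RAM) swap test: one call replaces the other. [cite: Serre1979, Ch. V §3 Cor. 3] [cite: Jacobowitz1962, §8] -/
theorem ramifiedBlock_adicCompletion_tame_of_wild (h2 : Valued.v (2 : w.1.adicCompletion L) = 1) :
    ∃ ϖ : w.1.adicCompletion L, Valued.v ϖ = WithZero.exp (-1 : ℤ) ∧ galAdicCompletionMap (L := L) (IsCMField.complexConj L) hw ϖ = -ϖ ∧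
      (∀ x : w.1.adicCompletion L, Valued.v x ≤ 1 → Valued.v (galAdicCompletionMap (L := L) (IsCMField.complexConj L) hw x - x) < 1) ∧
      (∀ u : w.1.adicCompletion L, galAdicCompletionMap (L := L) (IsCMField.complexConj L) hw u = u → Valued.v (u - 1) < 1 →
        ∃ z : w.1.adicCompletion L, z * galAdicCompletionMap (L := L) (IsCMField.complexConj L) hw z = u ∧ Valued.v (z - 1) ≤ Valued.v (u - 1)) := by
  obtain ⟨d, α, -, hdiff, hσα, -, hαiff, hres, hnorm⟩ := ramifiedBlock_adicCompletion_of_ramified L v w hw he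
  obtain ⟨hd, hα⟩ := ramifiedBlock_tame_of_valued_two_eq_one L v w hw he h2 hdiff hαiff
  subst hd
  refine ⟨α, hα, hσα, fun x hx => lt_of_le_of_lt (hres x hx) (by rw [← WithZero.exp_zero, Nat.cast_one, WithZero.exp_lt_exp]; norm_num), fun u hσu hu1 => ?_⟩
  -- a `σ`-fixed `u` descends: `u − 1 = ι y` has even valuation, so `|u − 1| < 1 ⇒ |u − 1| ≤ exp(−2)`
  obtain ⟨u', rfl⟩ := exists_toPlace_eq_of_galAdicCompletionMap_eq (IsCMField.complexConj L) w (IsCMField.complexConj_ne_one L) hw u hσu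
  have hy : Valued.v (toPlace v w u' - 1) = Valued.v (u' - 1) ^ 2 := by
    rw [← map_one (toPlace v w), ← map_sub, valued_toPlace_eq_sq_of_ramified L v w hw he]
  have hu2 : Valued.v (toPlace v w u' - 1) ≤ WithZero.exp (-(2 * ((1 : ℕ) : ℤ))) := by
    rw [hy] at hu1 ⊢
    have hlt : Valued.v (u' - 1) < 1 := by
      by_contra hge
      rw [not_lt] at hge
      exact absurd hu1 (not_lt.2 (by simpa only [one_pow] using pow_le_pow_left₀ zero_le hge 2))
    rcases eq_or_ne (Valued.v (u' - 1)) 0 with h0 | h0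
    · rw [h0, zero_pow two_ne_zero]; exact zero_le
    obtain ⟨m, hm⟩ : ∃ m : ℤ, Valued.v (u' - 1) = WithZero.exp m := ⟨_, (WithZero.exp_log h0).symm⟩
    rw [hm, ← WithZero.exp_zero, WithZero.exp_lt_exp] at hlt
    rw [hm, ← WithZero.exp_nsmul, WithZero.exp_le_exp]
    simp only [nsmul_eq_mul, Nat.cast_ofNat, Nat.cast_one, mul_one]
    omega
  obtain ⟨z, hz, hlev⟩ := hnorm _ hσu hu2
  refine ⟨z, hz, ?_⟩
  rw [Nat.cast_one] at hlev
  exact le_of_mul_exp_le_mul_exp hlev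

end Literature.NumberTheory.Automorphic.UnitaryGroup

end
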